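import Mathlib
import Summits.NavierStokesRegularity.NavierStokesRegularity.Theorems.HeteroclinicTriggerChainTriggerChainFrontStepLatticeCapture
import HarnessLib

/-!
# `HeteroclinicTriggerChain` — crux `TriggerChainFrontStep` (item stmt-NavierStokesRegularity-22785):
  the SEED ROW ON THE LATTICE — the upper trigger of an exact flow of the pinned table

Third phase of the lattice hop in envelope form (after `…LatticeDelay`, `…LatticeCapture`). For an exact
flow `S` of `α₀ + βσ` on `[0,T]` (`α₀` in normal form at `i₀`, parity at `i₁` for BOTH tables, `σ`
symmetric, `|α₀| ≤ 1`, `|σ| ≤ σ̄`), the upper trigger `v = S_{i₁,1}` obeys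

  `v′ = e′·y·v + β·s·x·u + f_v`,  `e′ = 2^{5/2}·d i₁ 0`, `s = 2·σ i₁ i₀ i₁ (0,0,1)`,

(`x = S_{i₀,0}`, `u = S_{i₁,0}`, `y = S_{i₀,1}`): the receiver-driven growth (the premature-ignition
clock), the SEED triad of `σ` (tree file `…ConnectionForm`; the normal form has NO such entry for `α₀`:
`α₀ i₁ i₀ i₁ (0,0,1) = 0`), and a remainder controlled by envelopes — `V ≥ |v|`, `Z ≥ |S_{b,2}|` (the
tail shell), `A₁ ≥ |S_{b,1}|`, `ι ≥` junk modes at shells `0, 1`, `M ≥ |u|`: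
`|f_v| ≤ 12V(2ι + 4Z + 4βσ̄(A₁ + Z)) + 12Z(2ι + 4βσ̄A₁) + 4Mι(1 + βσ̄)` (`htcLS_upper_trigger_forced`;
`2^{7/2} ≤ 12`). This is the input shape of the forced seed-deposit lemma (`…ForcedSeed`):
`e^{Λ(T)}(v(0) − φ_vT) + βs∫xu ≤ v(T) ≤ e^{Λ(T)}(v(0) + βs∫xu + φ_vT)`, `Λ = e′∫y`.

HONEST FRAMING: a statement about exact flows of Tao-type MODEL lattices (Tao 2016 §4) under envelope
hypotheses supplied elsewhere; helper for the crux (no stub credit); nothing here is a statement about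
the Navier–Stokes equations; no summit, rung or crux is proved.
-/

noncomputable section

set_option linter.dupNamespace false

open Real Set

namespace Summit.NavierStokesRegularity.NavierStokesRegularity.Theorems

open Literature.Analysis.FluidPDE Literature.Analysis.FluidPDE.TaoCascade

/-- A sum over the four modes with every term bounded by `B` is bounded by `4B`. [folklore] -/
theorem htcLS_abs_sum_le_four (F : Fin 4 → ℝ) {B : ℝ} (hB : ∀ a, |F a| ≤ B) : |∑ a, F a| ≤ 4 * B := by
  calc |∑ a, F a| ≤ ∑ a, |F a| := Finset.abs_sum_le_sum_abs _ _
    _ ≤ ∑ _a : Fin 4, B := Finset.sum_le_sum fun a _ => hB a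
    _ = 4 * B := by simp

/-- **THE SEED ROW ON THE LATTICE.** Setting of the module docstring. There is a remainder `f_v` with
`v′ = e′·y·v + β·s·x·u + f_v` on `[0,T]` (within the segment), `e′ = 2^{5/2} d i₁ 0`,
`s = 2σ i₁ i₀ i₁ (0,0,1)`, and `|f_v| ≤ 12V(2ι + 4Z + 4βσ̄(A₁ + Z)) + 12Z(2ι + 4βσ̄A₁) + 4Mι(1 + βσ̄)`.
[this file] -/
theorem htcLS_upper_trigger_forced (α₀ σ : Fin 4 → Fin 4 → Fin 4 → ℤ × ℤ × ℤ → ℝ) (i₀ i₁ : Fin 4)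
    (d : Fin 4 → ℤ → ℝ) (hne : i₀ ≠ i₁)
    (hsym : IsSymmetricCoeff α₀) (hcanc : IsCancellingCoeff α₀)
    (hpure : ∀ X : Fin 4 → ℤ → ℝ → ℝ, (∀ i n t, i ≠ i₀ → X i n t = 0) →
      ∀ i n t, quadTerm 1 α₀ X i n t = 0)
    (hsad : ∀ (Y : Fin 4 → ℤ → ℝ → ℝ) (i : Fin 4) (n : ℤ) (t : ℝ),
      quadTerm 1 α₀ (fun j m s => (fun j m (_ : ℝ) => if j = i₀ ∧ m = 0 then (1 : ℝ) else 0) j m s +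
          Y j m s) i n t -
        quadTerm 1 α₀ (fun j m (_ : ℝ) => if j = i₀ ∧ m = 0 then (1 : ℝ) else 0) i n t -
        quadTerm 1 α₀ Y i n t = d i n * Y i n t)
    (hpar : ∀ (j₁ j₂ j₃ : Fin 4) (μ : ℤ × ℤ × ℤ),
      Xor (Xor (j₁ = i₁) (j₂ = i₁)) (j₃ = i₁) → α₀ j₁ j₂ j₃ μ = 0)
    (hα1 : ∀ a b c μ, |α₀ a b c μ| ≤ 1)
    (hσsym : IsSymmetricCoeff σ)
    (hσpar : ∀ (j₁ j₂ j₃ : Fin 4) (μ : ℤ × ℤ × ℤ),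
      Xor (Xor (j₁ = i₁) (j₂ = i₁)) (j₃ = i₁) → σ j₁ j₂ j₃ μ = 0)
    {σb : ℝ} (hσ1 : ∀ a b c μ, |σ a b c μ| ≤ σb)
    (β : ℝ) (hβ : 0 ≤ β) (S : Fin 4 → ℤ → ℝ → ℝ) {T : ℝ}
    (hS : ∀ i k, ∀ t ∈ Icc 0 T, HasDerivWithinAt (S i k)
      (quadTerm 1 α₀ S i k t + β * quadTerm 1 σ S i k t) (Icc 0 T) t)
    {M V ι Z A₁ : ℝ} (hι0 : 0 ≤ ι)
    (hMu : ∀ t ∈ Icc 0 T, |S i₁ 0 t| ≤ M) (hV : ∀ t ∈ Icc 0 T, |S i₁ 1 t| ≤ V)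
    (hZ : ∀ t ∈ Icc 0 T, ∀ b, |S b 2 t| ≤ Z) (hA : ∀ t ∈ Icc 0 T, ∀ b, |S b 1 t| ≤ A₁)
    (hι : ∀ t ∈ Icc 0 T, ∀ a, a ≠ i₀ → a ≠ i₁ → |S a 0 t| ≤ ι ∧ |S a 1 t| ≤ ι) :
    ∃ fv : ℝ → ℝ,
      (∀ t ∈ Icc 0 T, HasDerivWithinAt (S i₁ 1)
        ((2 : ℝ) ^ ((5 : ℝ) / 2) * d i₁ 0 * S i₀ 1 t * S i₁ 1 t +
          β * (2 * σ i₁ i₀ i₁ (0, 0, 1)) * S i₀ 0 t * S i₁ 0 t + fv t) (Icc 0 T) t) ∧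
      (∀ t ∈ Icc 0 T, |fv t| ≤
        12 * V * (2 * ι + 4 * Z + 4 * β * σb * (A₁ + Z)) + 12 * Z * (2 * ι + 4 * β * σb * A₁) +
          4 * M * ι * (1 + β * σb)) := by
  obtain ⟨hc0, hc1, -, hc3⟩ := htcTR_trigger_carrier_coefficients α₀ i₀ i₁ d hsym hcanc hpure hsad
  have hpar3 : ∀ μ : ℤ × ℤ × ℤ, α₀ i₁ i₁ i₁ μ = 0 := fun μ => hpar i₁ i₁ i₁ μ (by simp [Xor])
  have hσpar3 : ∀ μ : ℤ × ℤ × ℤ, σ i₁ i₁ i₁ μ = 0 := fun μ => hσpar i₁ i₁ i₁ μ (by simp [Xor])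
  have hσ0 : 0 ≤ σb := (abs_nonneg _).trans (hσ1 i₀ i₀ i₀ (0, 0, 0))
  -- gains
  have hc₂0 : (0 : ℝ) ≤ (2 : ℝ) ^ ((5 : ℝ) / 2) := Real.rpow_nonneg (by norm_num) _
  have hc₂8 : (2 : ℝ) ^ ((5 : ℝ) / 2) ≤ 6 := by
    have h1 : (2 : ℝ) ^ ((5 : ℝ) / 2) = (2 : ℝ) ^ (2 : ℝ) * (2 : ℝ) ^ ((1 : ℝ) / 2) := by
      rw [← Real.rpow_add (by norm_num)]; norm_num
    have h2 : (2 : ℝ) ^ (2 : ℝ) = 4 := by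
      rw [show (2 : ℝ) = ((2 : ℕ) : ℝ) by norm_num, Real.rpow_natCast]; norm_num
    have h3 : (2 : ℝ) ^ ((1 : ℝ) / 2) ≤ 3 / 2 := by
      rw [← Real.sqrt_eq_rpow]
      rw [show (3 : ℝ) / 2 = Real.sqrt (9 / 4) by
        rw [show (9 : ℝ) / 4 = (3 / 2) ^ 2 by norm_num, Real.sqrt_sq (by norm_num)]]
      exact Real.sqrt_le_sqrt (by norm_num)
    rw [h1, h2]
    have : (0 : ℝ) ≤ (2 : ℝ) ^ ((1 : ℝ) / 2) := Real.rpow_nonneg (by norm_num) _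
    nlinarith
  refine ⟨fun t => (quadTerm 1 α₀ S i₁ 1 t + β * quadTerm 1 σ S i₁ 1 t) -
      ((2 : ℝ) ^ ((5 : ℝ) / 2) * d i₁ 0 * S i₀ 1 t * S i₁ 1 t +
        β * (2 * σ i₁ i₀ i₁ (0, 0, 1)) * S i₀ 0 t * S i₁ 0 t), ?_, ?_⟩
  · intro t ht
    exact (hS i₁ 1 t ht).congr_deriv (by ring)
  · intro t ht
    -- the two trigger rows at shell 1
    have hu := htcTR_quadTerm_trigger α₀ i₁ hsym hpar S 1 t
    have hσ := htcTR_quadTerm_trigger σ i₁ hσsym hσpar S 1 t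
    have g1 : (1 + 1 : ℝ) ^ ((5 : ℝ) * ((1 : ℤ) : ℝ) / 2) = (2 : ℝ) ^ ((5 : ℝ) / 2) := by norm_num
    have g0 : (1 + 1 : ℝ) ^ ((5 : ℝ) * (((1 : ℤ) : ℝ) - 1) / 2) = 1 := by norm_num
    have e11 : ((1 : ℤ) + 1) = 2 := by norm_num
    have e10 : ((1 : ℤ) - 1) = 0 := by norm_num
    rw [g1, g0, one_mul, e11, e10] at hu hσ
    -- envelopes at time t
    have hj0 : ∀ a, a ≠ i₀ → a ≠ i₁ → |S a 0 t| ≤ ι := fun a h0 h1 => (hι t ht a h0 h1).1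
    have hj1 : ∀ a, a ≠ i₀ → a ≠ i₁ → |S a 1 t| ≤ ι := fun a h0 h1 => (hι t ht a h0 h1).2
    have hZt : ∀ b, |S b 2 t| ≤ Z := hZ t ht
    have hAt : ∀ b, |S b 1 t| ≤ A₁ := hA t ht
    have hZ0 : 0 ≤ Z := (abs_nonneg _).trans (hZt i₀)
    have hA0 : 0 ≤ A₁ := (abs_nonneg _).trans (hAt i₀)
    have hV0 : 0 ≤ V := (abs_nonneg _).trans (hV t ht)
    have hM0 : 0 ≤ M := (abs_nonneg _).trans (hMu t ht)
    -- pointwise bounds for products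
    have hjb : ∀ (c z B : ℝ), |c| ≤ 1 → |z| ≤ B → |c * z| ≤ B := fun c z B hc hz => by
      rw [abs_mul]
      calc |c| * |z| ≤ 1 * B := mul_le_mul hc hz (abs_nonneg _) (by norm_num)
        _ = B := one_mul _
    have hσb : ∀ (c z B : ℝ), |c| ≤ σb → |z| ≤ B → |c * z| ≤ σb * B := fun c z B hc hz => by
      rw [abs_mul]; exact mul_le_mul hc hz (abs_nonneg _) hσ0
    -- α₀ sums
    -- (000) at shell 1: (e/2) y + junk
    set P₀ : ℝ := ∑ b, α₀ i₁ b i₁ (0, 0, 0) * S b 1 t - d i₁ 0 / 2 * S i₀ 1 t with hP₀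
    have hBP₀ : |P₀| ≤ 2 * ι := by
      have h := htcLC_sum_split (fun b => α₀ i₁ b i₁ (0, 0, 0) * S b 1 t) hne (B := ι)
        (fun a h0 h1 => hjb _ _ _ (hα1 _ _ _ _) (hj1 a h0 h1))
      have key : P₀ = ∑ b, α₀ i₁ b i₁ (0, 0, 0) * S b 1 t - α₀ i₁ i₀ i₁ (0, 0, 0) * S i₀ 1 t -
          α₀ i₁ i₁ i₁ (0, 0, 0) * S i₁ 1 t := by rw [hP₀, hc0, hpar3]; ring
      rw [key]; exact h
    -- (100)a at shell 1: ζ · Σ_b α₀ i₁ b i₁ (100) S_{b,1}: generic bound 4 A₁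
    set P₁ : ℝ := ∑ b, α₀ i₁ b i₁ (1, 0, 0) * S b 1 t with hP₁
    have hBP₁ : |P₁| ≤ 2 * ι := by
      have h := htcLC_sum_split (fun b => α₀ i₁ b i₁ (1, 0, 0) * S b 1 t) hne (B := ι)
        (fun a h0 h1 => hjb _ _ _ (hα1 _ _ _ _) (hj1 a h0 h1))
      have key : P₁ = ∑ b, α₀ i₁ b i₁ (1, 0, 0) * S b 1 t - α₀ i₁ i₀ i₁ (1, 0, 0) * S i₀ 1 t -
          α₀ i₁ i₁ i₁ (1, 0, 0) * S i₁ 1 t := by rw [hP₁, hc1, hpar3]; ring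
      rw [key]; exact h
    -- (100)b: v · Σ_b α₀ b i₁ i₁ (100) S_{b,2}: generic bound 4 Z
    set P₂ : ℝ := ∑ b, α₀ b i₁ i₁ (1, 0, 0) * S b 2 t with hP₂
    have hBP₂ : |P₂| ≤ 4 * Z := htcLS_abs_sum_le_four _ fun b => hjb _ _ _ (hα1 _ _ _ _) (hZt b)
    -- (001) from shell 0: u · (junk only)
    set P₃ : ℝ := ∑ b, α₀ i₁ b i₁ (0, 0, 1) * S b 0 t with hP₃
    have hBP₃ : |P₃| ≤ 2 * ι := by
      have h := htcLC_sum_split (fun b => α₀ i₁ b i₁ (0, 0, 1) * S b 0 t) hne (B := ι)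
        (fun a h0 h1 => hjb _ _ _ (hα1 _ _ _ _) (hj0 a h0 h1))
      have key : P₃ = ∑ b, α₀ i₁ b i₁ (0, 0, 1) * S b 0 t - α₀ i₁ i₀ i₁ (0, 0, 1) * S i₀ 0 t -
          α₀ i₁ i₁ i₁ (0, 0, 1) * S i₁ 0 t := by rw [hP₃, hc3, hpar3]; ring
      rw [key]; exact h
    -- σ sums
    set Q₀ : ℝ := ∑ b, σ i₁ b i₁ (0, 0, 0) * S b 1 t with hQ₀
    have hBQ₀ : |Q₀| ≤ 4 * (σb * A₁) := htcLS_abs_sum_le_four _ fun b => hσb _ _ _ (hσ1 _ _ _ _) (hAt b)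
    set Q₁ : ℝ := ∑ b, σ i₁ b i₁ (1, 0, 0) * S b 1 t with hQ₁
    have hBQ₁ : |Q₁| ≤ 4 * (σb * A₁) := htcLS_abs_sum_le_four _ fun b => hσb _ _ _ (hσ1 _ _ _ _) (hAt b)
    set Q₂ : ℝ := ∑ b, σ b i₁ i₁ (1, 0, 0) * S b 2 t with hQ₂
    have hBQ₂ : |Q₂| ≤ 4 * (σb * Z) := htcLS_abs_sum_le_four _ fun b => hσb _ _ _ (hσ1 _ _ _ _) (hZt b)
    -- σ (001) from shell 0: the SEED (s/2)·x + junk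
    set Q₃ : ℝ := ∑ b, σ i₁ b i₁ (0, 0, 1) * S b 0 t - σ i₁ i₀ i₁ (0, 0, 1) * S i₀ 0 t with hQ₃
    have hBQ₃ : |Q₃| ≤ 2 * (σb * ι) := by
      have h := htcLC_sum_split (fun b => σ i₁ b i₁ (0, 0, 1) * S b 0 t) hne (B := σb * ι)
        (fun a h0 h1 => hσb _ _ _ (hσ1 _ _ _ _) (hj0 a h0 h1))
      have key : Q₃ = ∑ b, σ i₁ b i₁ (0, 0, 1) * S b 0 t - σ i₁ i₀ i₁ (0, 0, 1) * S i₀ 0 t -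
          σ i₁ i₁ i₁ (0, 0, 1) * S i₁ 0 t := by rw [hQ₃, hσpar3]; ring
      rw [key]; exact h
    -- the identity
    have heq : (quadTerm 1 α₀ S i₁ 1 t + β * quadTerm 1 σ S i₁ 1 t) -
        ((2 : ℝ) ^ ((5 : ℝ) / 2) * d i₁ 0 * S i₀ 1 t * S i₁ 1 t +
          β * (2 * σ i₁ i₀ i₁ (0, 0, 1)) * S i₀ 0 t * S i₁ 0 t) =
        (2 : ℝ) ^ ((5 : ℝ) / 2) * (2 * S i₁ 1 t * P₀ + 2 * S i₁ 2 t * P₁ + 2 * S i₁ 1 t * P₂) +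
          2 * S i₁ 0 t * P₃ +
          β * ((2 : ℝ) ^ ((5 : ℝ) / 2) * (2 * S i₁ 1 t * Q₀ + 2 * S i₁ 2 t * Q₁ + 2 * S i₁ 1 t * Q₂) +
            2 * S i₁ 0 t * Q₃) := by
      rw [hu, hσ, hP₀, hP₁, hP₂, hP₃, hQ₀, hQ₁, hQ₂, hQ₃]; ring
    show |(quadTerm 1 α₀ S i₁ 1 t + β * quadTerm 1 σ S i₁ 1 t) -
        ((2 : ℝ) ^ ((5 : ℝ) / 2) * d i₁ 0 * S i₀ 1 t * S i₁ 1 t +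
          β * (2 * σ i₁ i₀ i₁ (0, 0, 1)) * S i₀ 0 t * S i₁ 0 t)| ≤ _
    rw [heq]
    -- term bounds
    have hv := hV t ht
    have hz := hZt i₁
    have huM := hMu t ht
    have t1 : |2 * S i₁ 1 t * P₀| ≤ 2 * V * (2 * ι) := by
      rw [abs_mul, abs_mul, abs_two]
      exact mul_le_mul (by linarith) hBP₀ (abs_nonneg _) (by linarith)
    have t2 : |2 * S i₁ 2 t * P₁| ≤ 2 * Z * (2 * ι) := by
      rw [abs_mul, abs_mul, abs_two]
      exact mul_le_mul (by linarith) hBP₁ (abs_nonneg _) (by linarith)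
    have t3 : |2 * S i₁ 1 t * P₂| ≤ 2 * V * (4 * Z) := by
      rw [abs_mul, abs_mul, abs_two]
      exact mul_le_mul (by linarith) hBP₂ (abs_nonneg _) (by linarith)
    have t4 : |2 * S i₁ 0 t * P₃| ≤ 2 * M * (2 * ι) := by
      rw [abs_mul, abs_mul, abs_two]
      exact mul_le_mul (by linarith) hBP₃ (abs_nonneg _) (by linarith)
    have t5 : |2 * S i₁ 1 t * Q₀| ≤ 2 * V * (4 * (σb * A₁)) := by
      rw [abs_mul, abs_mul, abs_two]
      exact mul_le_mul (by linarith) hBQ₀ (abs_nonneg _) (by linarith)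
    have t6 : |2 * S i₁ 2 t * Q₁| ≤ 2 * Z * (4 * (σb * A₁)) := by
      rw [abs_mul, abs_mul, abs_two]
      exact mul_le_mul (by linarith) hBQ₁ (abs_nonneg _) (by linarith)
    have t7 : |2 * S i₁ 1 t * Q₂| ≤ 2 * V * (4 * (σb * Z)) := by
      rw [abs_mul, abs_mul, abs_two]
      exact mul_le_mul (by linarith) hBQ₂ (abs_nonneg _) (by linarith)
    have t8 : |2 * S i₁ 0 t * Q₃| ≤ 2 * M * (2 * (σb * ι)) := by
      rw [abs_mul, abs_mul, abs_two]
      exact mul_le_mul (by linarith) hBQ₃ (abs_nonneg _) (by linarith)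
    -- assemble
    have hA : |(2 : ℝ) ^ ((5 : ℝ) / 2) * (2 * S i₁ 1 t * P₀ + 2 * S i₁ 2 t * P₁ + 2 * S i₁ 1 t * P₂)|
        ≤ 6 * (2 * V * (2 * ι) + 2 * Z * (2 * ι) + 2 * V * (4 * Z)) := by
      rw [abs_mul, abs_of_nonneg hc₂0]
      have hin : |2 * S i₁ 1 t * P₀ + 2 * S i₁ 2 t * P₁ + 2 * S i₁ 1 t * P₂| ≤
          2 * V * (2 * ι) + 2 * Z * (2 * ι) + 2 * V * (4 * Z) := by
        calc _ ≤ |2 * S i₁ 1 t * P₀ + 2 * S i₁ 2 t * P₁| + |2 * S i₁ 1 t * P₂| := abs_add_le _ _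
          _ ≤ |2 * S i₁ 1 t * P₀| + |2 * S i₁ 2 t * P₁| + |2 * S i₁ 1 t * P₂| := by
              linarith [abs_add_le (2 * S i₁ 1 t * P₀) (2 * S i₁ 2 t * P₁)]
          _ ≤ _ := by linarith
      have hpos : 0 ≤ 2 * V * (2 * ι) + 2 * Z * (2 * ι) + 2 * V * (4 * Z) := by positivity
      calc (2 : ℝ) ^ ((5 : ℝ) / 2) * |2 * S i₁ 1 t * P₀ + 2 * S i₁ 2 t * P₁ + 2 * S i₁ 1 t * P₂|
          ≤ 6 * |2 * S i₁ 1 t * P₀ + 2 * S i₁ 2 t * P₁ + 2 * S i₁ 1 t * P₂| :=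
            mul_le_mul_of_nonneg_right hc₂8 (abs_nonneg _)
        _ ≤ _ := by linarith
    have hB : |β * ((2 : ℝ) ^ ((5 : ℝ) / 2) * (2 * S i₁ 1 t * Q₀ + 2 * S i₁ 2 t * Q₁ + 2 * S i₁ 1 t * Q₂) +
        2 * S i₁ 0 t * Q₃)| ≤
        β * (6 * (2 * V * (4 * (σb * A₁)) + 2 * Z * (4 * (σb * A₁)) + 2 * V * (4 * (σb * Z))) +
          2 * M * (2 * (σb * ι))) := by
      rw [abs_mul, abs_of_nonneg hβ]
      refine mul_le_mul_of_nonneg_left ?_ hβ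
      have hin : |2 * S i₁ 1 t * Q₀ + 2 * S i₁ 2 t * Q₁ + 2 * S i₁ 1 t * Q₂| ≤
          2 * V * (4 * (σb * A₁)) + 2 * Z * (4 * (σb * A₁)) + 2 * V * (4 * (σb * Z)) := by
        calc _ ≤ |2 * S i₁ 1 t * Q₀ + 2 * S i₁ 2 t * Q₁| + |2 * S i₁ 1 t * Q₂| := abs_add_le _ _
          _ ≤ |2 * S i₁ 1 t * Q₀| + |2 * S i₁ 2 t * Q₁| + |2 * S i₁ 1 t * Q₂| := by
              linarith [abs_add_le (2 * S i₁ 1 t * Q₀) (2 * S i₁ 2 t * Q₁)]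
          _ ≤ _ := by linarith
      have hpos : 0 ≤ 2 * V * (4 * (σb * A₁)) + 2 * Z * (4 * (σb * A₁)) + 2 * V * (4 * (σb * Z)) := by
        positivity
      calc |(2 : ℝ) ^ ((5 : ℝ) / 2) * (2 * S i₁ 1 t * Q₀ + 2 * S i₁ 2 t * Q₁ + 2 * S i₁ 1 t * Q₂) +
            2 * S i₁ 0 t * Q₃|
          ≤ |(2 : ℝ) ^ ((5 : ℝ) / 2) * (2 * S i₁ 1 t * Q₀ + 2 * S i₁ 2 t * Q₁ + 2 * S i₁ 1 t * Q₂)| +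
            |2 * S i₁ 0 t * Q₃| := abs_add_le _ _
        _ ≤ 6 * (2 * V * (4 * (σb * A₁)) + 2 * Z * (4 * (σb * A₁)) + 2 * V * (4 * (σb * Z))) +
            2 * M * (2 * (σb * ι)) := by
            rw [abs_mul, abs_of_nonneg hc₂0]
            have := mul_le_mul hc₂8 hin (abs_nonneg _) (by norm_num)
            linarith
    calc |(2 : ℝ) ^ ((5 : ℝ) / 2) * (2 * S i₁ 1 t * P₀ + 2 * S i₁ 2 t * P₁ + 2 * S i₁ 1 t * P₂) +
          2 * S i₁ 0 t * P₃ +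
          β * ((2 : ℝ) ^ ((5 : ℝ) / 2) * (2 * S i₁ 1 t * Q₀ + 2 * S i₁ 2 t * Q₁ + 2 * S i₁ 1 t * Q₂) +
            2 * S i₁ 0 t * Q₃)|
        ≤ |(2 : ℝ) ^ ((5 : ℝ) / 2) * (2 * S i₁ 1 t * P₀ + 2 * S i₁ 2 t * P₁ + 2 * S i₁ 1 t * P₂) +
            2 * S i₁ 0 t * P₃| +
          |β * ((2 : ℝ) ^ ((5 : ℝ) / 2) * (2 * S i₁ 1 t * Q₀ + 2 * S i₁ 2 t * Q₁ + 2 * S i₁ 1 t * Q₂) +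
            2 * S i₁ 0 t * Q₃)| := abs_add_le _ _
      _ ≤ |(2 : ℝ) ^ ((5 : ℝ) / 2) * (2 * S i₁ 1 t * P₀ + 2 * S i₁ 2 t * P₁ + 2 * S i₁ 1 t * P₂)| +
            |2 * S i₁ 0 t * P₃| +
          |β * ((2 : ℝ) ^ ((5 : ℝ) / 2) * (2 * S i₁ 1 t * Q₀ + 2 * S i₁ 2 t * Q₁ + 2 * S i₁ 1 t * Q₂) +
            2 * S i₁ 0 t * Q₃)| := by
          linarith [abs_add_le ((2 : ℝ) ^ ((5 : ℝ) / 2) *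
            (2 * S i₁ 1 t * P₀ + 2 * S i₁ 2 t * P₁ + 2 * S i₁ 1 t * P₂)) (2 * S i₁ 0 t * P₃)]
      _ ≤ 6 * (2 * V * (2 * ι) + 2 * Z * (2 * ι) + 2 * V * (4 * Z)) + 2 * M * (2 * ι) +
          (β * (6 * (2 * V * (4 * (σb * A₁)) + 2 * Z * (4 * (σb * A₁)) + 2 * V * (4 * (σb * Z))) +
            2 * M * (2 * (σb * ι)))) := by linarith
      _ = 12 * V * (2 * ι + 4 * Z + 4 * β * σb * (A₁ + Z)) + 12 * Z * (2 * ι + 4 * β * σb * A₁) +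
          4 * M * ι * (1 + β * σb) := by ring

end Summit.NavierStokesRegularity.NavierStokesRegularity.Theorems

end
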